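import Summits.QuantumFields.YangMills.Theorems.HypercubicLimit.Negative.NonTrivialityBridge
import Summits.QuantumFields.YangMills.Theorems.InfraredLiouvilleStrongCouplingIRTrivialTwoPoint
import Literature.Analysis.FunctionSpaces.SchwartzSubspaceBanachSteinhaus

/-!
# `HypercubicLimit` — negative-side support: the convergence clause UPGRADES ITSELF (Banach–Steinhaus)

Support file for crux `stmt-QuantumFields-16154` (`CoincidenceRotationBootstrap.HypercubicLimit` =
`MirrorModularBoosts.WeakCouplingHypercubicLimit`; equally the 8646 body), from the standing disprover's work
file `Cruxes/HypercubicLimit/Disproof.lean` (cycle 1 of 16154).  The census of the β-free predecessor recorded,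
as the obstruction to several adversary AND prover arguments (lattice reflection positivity ⇒ E2 of the limit,
lattice translations ⇒ translation invariance of the limit, Osterwalder–Seiler clustering at small `β` ⇒ no
witness beyond M-adic schemes), that "passing to the limit would need a modulus of continuity of the lattice
functionals in the test function, uniform in `k`, which the statement does not provide".  It DOES provide one:
the lattice two-point functionals `(u, v) ↦ ⟨Φ_k(u) Φ_k(v)⟩` are continuous bilinear forms on `𝓢 × 𝓢` (finite sums
of point evaluations, `latticeSchwinger_two_eq`), the convergence clause makes them pointwise convergent on every
pair of CLOSED subspaces of `𝓢(ℝ⁴, ℝ)` whose tensors are off-diagonal, closed subspaces of `𝓢` are Fréchet hence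
Baire, and the multilinear Banach–Steinhaus theorem of the tree
(`Literature.Analysis.FunctionSpaces.tendsto_apply_of_pointwise_tendsto_schwartzSubmodule`) gives joint
continuity of the limiting process:

* `converges_two_along_tendsto`: under the convergence clause, for closed submodules `S₀, S₁ ≤ 𝓢(ℝ⁴, ℝ)` with
  `u ⊗ v ∈ ⁰𝒮` for `u ∈ S₀, v ∈ S₁`, and sequences `u_k → u₀` in `S₀`, `v_k → v₀` in `S₁`:
  `⟨Φ_k(u_k) Φ_k(v_k)⟩ → 𝔖₂(u₀ ⊗ v₀)` — the test functions may MOVE with the lattice (lattice-vector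
  approximations of continuum shifts, averages over cube corners, `a_k`-difference quotients …), whatever the
  renormalisation constants `c_k`.
* `converges_two_along_tendsto_timeSlabs`: the instance used by time-reflection arguments — `u_k, u₀` vanishing on
  `{t > −δ}`, `v_k, v₀` vanishing on `{t < δ}` (`δ > 0`; these are closed submodules and their tensors are
  off-diagonal, `isOffDiagonal_of_halfSpaces`).

What this does NOT repair (recorded in the work file §11/§13): the time reflection of the smeared curvature is the
smeared REFLECTED density (temporal plaquettes hang down), which is not a curvature smearing of any test function —
the electric/magnetic split, not the modulus of continuity, is the remaining obstruction to "uniform lattice-unit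
clustering ⇒ no non-trivial limit". [folklore]
-/

noncomputable section

open scoped SchwartzMap BigOperators
open MeasureTheory Filter Topology Complex Finset
open Literature.MathematicalPhysics.AQFT Literature.MathematicalPhysics.QuantumLattice
open Literature.MathematicalPhysics.QuantumFieldTheory
open Literature.Probability.LatticeModels (Site box)
open Summit.QuantumFields.YangMills.Theorems.StrongCouplingIRTrivial.TwoPoint (latticeSchwinger_two_eq centredKernel)

namespace Summit.QuantumFields.YangMills.Theorems.HypercubicLimit.Negative

section BanachSteinhaus

variable {G : Type} [Group G] [TopologicalSpace G] [IsTopologicalGroup G] [CompactSpace G]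
  [MeasurableSpace G] [BorelSpace G]

/-- Point evaluation is continuous on the Schwartz space (via the bounded-continuous-function embedding).
[folklore] -/
theorem continuous_eval_schwartz (p : EuclideanSpace ℝ (Fin 4)) :
    Continuous fun f : 𝓢(EuclideanSpace ℝ (Fin 4), ℝ) => f p := by
  have h := ((BoundedContinuousFunction.evalCLM ℝ p).comp
    (SchwartzMap.toBoundedContinuousFunctionCLM ℝ (EuclideanSpace ℝ (Fin 4)) ℝ)).continuous
  exact h.congr fun f => by simp

/-- A complex limit of real numbers is real. [folklore] -/
theorem im_eq_zero_of_tendsto_ofReal {x : ℕ → ℝ} {z : ℂ}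
    (h : Tendsto (fun k => ((x k : ℝ) : ℂ)) atTop (𝓝 z)) : z.im = 0 := by
  have h1 : Tendsto (fun k => ((x k : ℝ) : ℂ).im) atTop (𝓝 z.im) := (continuous_im.tendsto z).comp h
  simp only [ofReal_im] at h1
  exact tendsto_nhds_unique h1 tendsto_const_nhds

/-- **The convergence clause upgrades itself (multilinear Banach–Steinhaus on closed subspaces of `𝓢`).**
Under the crux's convergence clause, for every species string `σ` of length two, every pair of CLOSED
submodules `S₀, S₁` of `𝓢(ℝ⁴, ℝ)` whose real tensors `u ⊗ v` (`u ∈ S₀`, `v ∈ S₁`) are off-diagonal, and all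
sequences `u_k → u₀` in `S₀`, `v_k → v₀` in `S₁`, the joint lattice two-point functions along MOVING test functions
converge to the limit at the limit test functions: `⟨Φ^{σ₀}_k(u_k) Φ^{σ₁}_k(v_k)⟩ → 𝔖₂^σ(u₀ ⊗ v₀)`.  No condition on the
scheme (`c_k, m_k, a_k, β_k, L_k` arbitrary). [folklore] -/
theorem converges_two_along_tendsto (r : LatticeRep G) (sch : SpeciesScheme (YMSpecies G))
    (S : LabelledSchwingerFamily (YMSpecies G) (EuclideanSpace ℝ (Fin 4)))
    (hconv : ∀ (n : ℕ), n ≠ 0 → ∀ (σ : Fin n → YMSpecies G) (f : Fin n → 𝓢((EuclideanSpace ℝ (Fin 4)), ℝ))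
      (F : 𝓢((Fin n → (EuclideanSpace ℝ (Fin 4))), ℂ)), IsTensorOf F (fun i => ofRealTest (f i)) →
        IsOffDiagonal F →
        Tendsto (fun k : ℕ => ((latticeSchwinger r.ρ sch (fun s => s.F) k n σ f : ℝ) : ℂ))
          atTop (𝓝 (S n σ F)))
    (σ : Fin (1 + 1) → YMSpecies G) (S₀ S₁ : Submodule ℝ 𝓢(EuclideanSpace ℝ (Fin 4), ℝ))
    (h₀ : IsClosed (S₀ : Set 𝓢(EuclideanSpace ℝ (Fin 4), ℝ)))
    (h₁ : IsClosed (S₁ : Set 𝓢(EuclideanSpace ℝ (Fin 4), ℝ)))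
    (hoff : ∀ u ∈ S₀, ∀ v ∈ S₁, IsOffDiagonal (tensor₂ u v))
    {u : ℕ → S₀} {u₀ : S₀} (hu : Tendsto u atTop (𝓝 u₀))
    {v : ℕ → S₁} {v₀ : S₁} (hv : Tendsto v atTop (𝓝 v₀)) :
    Tendsto (fun k : ℕ => ((latticeSchwinger r.ρ sch (fun s => s.F) k (1 + 1) σ
        ![((u k : S₀) : 𝓢(EuclideanSpace ℝ (Fin 4), ℝ)), ((v k : S₁) : 𝓢(EuclideanSpace ℝ (Fin 4), ℝ))] : ℝ) : ℂ))
      atTop (𝓝 (S (1 + 1) σ (tensor₂ ((u₀ : S₀) : 𝓢(EuclideanSpace ℝ (Fin 4), ℝ))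
        ((v₀ : S₁) : 𝓢(EuclideanSpace ℝ (Fin 4), ℝ))))) := by
  -- the two closed subspaces as a `Fin 2`-family
  let Sub : Fin (1 + 1) → Submodule ℝ 𝓢(EuclideanSpace ℝ (Fin 4), ℝ) := ![S₀, S₁]
  have hSub : ∀ i, IsClosed ((Sub i : Submodule ℝ 𝓢(EuclideanSpace ℝ (Fin 4), ℝ)) :
      Set 𝓢(EuclideanSpace ℝ (Fin 4), ℝ)) := by
    intro i; fin_cases i
    · exact h₀
    · exact h₁
  -- the real-valued lattice two-point functional, and its complexification = `latticeSchwinger`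
  let L : ℕ → 𝓢(EuclideanSpace ℝ (Fin 4), ℝ) → 𝓢(EuclideanSpace ℝ (Fin 4), ℝ) → ℝ := fun k a b =>
    latticeSchwinger r.ρ sch (fun s => s.F) k (1 + 1) σ ![a, b]
  -- closed form: a finite double sum of products of point evaluations
  let coef : ℕ → Site 4 → Site 4 → ℝ := fun k x y =>
    sch.c (σ 0) k * sch.c (σ 1) k * sch.a k ^ 8 *
      centredKernel r.ρ (sch.β k) (sch.side k) (σ 0).F (σ 1).F (sch.m (σ 0) k) (sch.m (σ 1) k) x y
  have hL : ∀ k a b, L k a b = ∑ x ∈ box 4 (sch.L k), ∑ y ∈ box 4 (sch.L k),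
      coef k x y * (a (sch.a k • siteToE x) * b (sch.a k • siteToE y)) := by
    intro k a b
    have h := latticeSchwinger_two_eq r.ρ r.continuous sch (fun s : YMSpecies G => s.F) k σ ![a, b]
      (fun i => (σ i).measurable) (fun i => (σ i).bounded)
    simp only [L]
    rw [h, Finset.mul_sum]
    refine Finset.sum_congr rfl fun x _ => ?_
    rw [Finset.mul_sum]
    refine Finset.sum_congr rfl fun y _ => ?_
    simp only [coef, Matrix.cons_val_zero, Matrix.cons_val_one]
    ring
  -- point evaluations on the subspaces, as linear maps
  let ev : EuclideanSpace ℝ (Fin 4) → (𝓢(EuclideanSpace ℝ (Fin 4), ℝ) →ₗ[ℝ] ℝ) := fun p =>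
    ((BoundedContinuousFunction.evalCLM ℝ p).comp
      (SchwartzMap.toBoundedContinuousFunctionCLM ℝ (EuclideanSpace ℝ (Fin 4)) ℝ)).toLinearMap
  have hev : ∀ p (f : 𝓢(EuclideanSpace ℝ (Fin 4), ℝ)), ev p f = f p := fun p f => by
    simp [ev]
  let pt : ℕ → Site 4 → Site 4 → Fin (1 + 1) → EuclideanSpace ℝ (Fin 4) := fun k x y =>
    ![sch.a k • siteToE x, sch.a k • siteToE y]
  let B : ℕ → Site 4 → Site 4 → MultilinearMap ℝ (fun i => ↥(Sub i)) ℝ := fun k x y =>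
    (MultilinearMap.mkPiAlgebra ℝ (Fin (1 + 1)) ℝ).compLinearMap
      (fun i => (ev (pt k x y i)) ∘ₗ (Sub i).subtype)
  have hB : ∀ k x y (m : ∀ i, ↥(Sub i)), B k x y m =
      ((m 0 : ↥(Sub 0)) : 𝓢(EuclideanSpace ℝ (Fin 4), ℝ)) (sch.a k • siteToE x) *
        ((m 1 : ↥(Sub 1)) : 𝓢(EuclideanSpace ℝ (Fin 4), ℝ)) (sch.a k • siteToE y) := by
    intro k x y m
    simp only [B, MultilinearMap.compLinearMap_apply, MultilinearMap.mkPiAlgebra_apply,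
      LinearMap.coe_comp, Function.comp_apply, Submodule.coe_subtype, hev]
    simp [pt]
  let T : ℕ → MultilinearMap ℝ (fun i => ↥(Sub i)) ℝ := fun k =>
    ∑ x ∈ box 4 (sch.L k), ∑ y ∈ box 4 (sch.L k), coef k x y • B k x y
  have hT_apply : ∀ k (m : ∀ i, ↥(Sub i)), T k m =
      L k ((m 0 : ↥(Sub 0)) : 𝓢(EuclideanSpace ℝ (Fin 4), ℝ))
        ((m 1 : ↥(Sub 1)) : 𝓢(EuclideanSpace ℝ (Fin 4), ℝ)) := by
    intro k m
    rw [hL]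
    simp [T, hB]
  have hT_cont : ∀ k, Continuous (T k) := by
    intro k
    have hc : Continuous fun m : ∀ i, ↥(Sub i) =>
        L k ((m 0 : ↥(Sub 0)) : 𝓢(EuclideanSpace ℝ (Fin 4), ℝ))
          ((m 1 : ↥(Sub 1)) : 𝓢(EuclideanSpace ℝ (Fin 4), ℝ)) := by
      simp only [hL]
      refine continuous_finsetSum _ fun x _ => continuous_finsetSum _ fun y _ =>
        continuous_const.mul ((Continuous.mul ?_ ?_))
      · exact (continuous_eval_schwartz _).comp (continuous_subtype_val.comp (continuous_apply 0))
      · exact (continuous_eval_schwartz _).comp (continuous_subtype_val.comp (continuous_apply 1))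
    exact hc.congr fun m => (hT_apply k m).symm
  -- pointwise convergence on the subspaces, from the convergence clause
  let Tlim : (∀ i, ↥(Sub i)) → ℝ := fun m =>
    (S (1 + 1) σ (tensor₂ ((m 0 : ↥(Sub 0)) : 𝓢(EuclideanSpace ℝ (Fin 4), ℝ))
      ((m 1 : ↥(Sub 1)) : 𝓢(EuclideanSpace ℝ (Fin 4), ℝ)))).re
  have hconv₂ : ∀ a ∈ S₀, ∀ b ∈ S₁,
      Tendsto (fun k => ((L k a b : ℝ) : ℂ)) atTop (𝓝 (S (1 + 1) σ (tensor₂ a b))) := by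
    intro a ha b hb
    exact hconv (1 + 1) (by norm_num) σ ![a, b] (tensor₂ a b) (isTensorOf_tensor₂ a b) (hoff a ha b hb)
  have hT_conv : ∀ m, Tendsto (fun k => T k m) atTop (𝓝 (Tlim m)) := by
    intro m
    have hm := hconv₂ _ (m 0).2 _ (m 1).2
    have hre := (continuous_re.tendsto _).comp hm
    simp only [Function.comp_def, ofReal_re] at hre
    simpa only [hT_apply] using hre
  -- the moving arguments
  let X : ℕ → ∀ i, ↥(Sub i) := fun k i =>
    ⟨(![((u k : S₀) : 𝓢(EuclideanSpace ℝ (Fin 4), ℝ)), ((v k : S₁) : 𝓢(EuclideanSpace ℝ (Fin 4), ℝ))] :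
        Fin (1 + 1) → 𝓢(EuclideanSpace ℝ (Fin 4), ℝ)) i, by
      fin_cases i
      · exact (u k).2
      · exact (v k).2⟩
  let X₀ : ∀ i, ↥(Sub i) := fun i =>
    ⟨(![((u₀ : S₀) : 𝓢(EuclideanSpace ℝ (Fin 4), ℝ)), ((v₀ : S₁) : 𝓢(EuclideanSpace ℝ (Fin 4), ℝ))] :
        Fin (1 + 1) → 𝓢(EuclideanSpace ℝ (Fin 4), ℝ)) i, by
      fin_cases i
      · exact u₀.2
      · exact v₀.2⟩
  have hX : Tendsto X atTop (𝓝 X₀) := by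
    rw [tendsto_pi_nhds]
    intro i
    rw [tendsto_subtype_rng]
    fin_cases i
    · simpa [X, X₀, Function.comp_def] using (continuous_subtype_val.tendsto u₀).comp hu
    · simpa [X, X₀, Function.comp_def] using (continuous_subtype_val.tendsto v₀).comp hv
  -- Banach–Steinhaus on the closed subspaces of `𝓢`
  have hmain := Literature.Analysis.FunctionSpaces.tendsto_apply_of_pointwise_tendsto_schwartzSubmodule
    (G := ℝ) Sub hSub T hT_cont Tlim hT_conv hX
  -- unpack: real convergence of the lattice two-point functions along the moving test functions
  have hreal : Tendsto (fun k => L k ((u k : S₀) : 𝓢(EuclideanSpace ℝ (Fin 4), ℝ))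
      ((v k : S₁) : 𝓢(EuclideanSpace ℝ (Fin 4), ℝ))) atTop
      (𝓝 (S (1 + 1) σ (tensor₂ ((u₀ : S₀) : 𝓢(EuclideanSpace ℝ (Fin 4), ℝ))
        ((v₀ : S₁) : 𝓢(EuclideanSpace ℝ (Fin 4), ℝ)))).re) := by
    have e1 : (fun k => T k (X k)) = fun k => L k ((u k : S₀) : 𝓢(EuclideanSpace ℝ (Fin 4), ℝ))
        ((v k : S₁) : 𝓢(EuclideanSpace ℝ (Fin 4), ℝ)) := by
      funext k
      simp [hT_apply, X]
    have e2 : Tlim X₀ = (S (1 + 1) σ (tensor₂ ((u₀ : S₀) : 𝓢(EuclideanSpace ℝ (Fin 4), ℝ))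
        ((v₀ : S₁) : 𝓢(EuclideanSpace ℝ (Fin 4), ℝ)))).re := by
      simp [Tlim, X₀]
    rw [e1, e2] at hmain
    exact hmain
  -- the limit is real (a limit of real numbers at the fixed pair `(u₀, v₀)`), so upgrade to `ℂ`
  have him : (S (1 + 1) σ (tensor₂ ((u₀ : S₀) : 𝓢(EuclideanSpace ℝ (Fin 4), ℝ))
      ((v₀ : S₁) : 𝓢(EuclideanSpace ℝ (Fin 4), ℝ)))).im = 0 :=
    im_eq_zero_of_tendsto_ofReal (hconv₂ _ u₀.2 _ v₀.2)
  have hz : ((S (1 + 1) σ (tensor₂ ((u₀ : S₀) : 𝓢(EuclideanSpace ℝ (Fin 4), ℝ))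
      ((v₀ : S₁) : 𝓢(EuclideanSpace ℝ (Fin 4), ℝ)))).re : ℂ) =
      S (1 + 1) σ (tensor₂ ((u₀ : S₀) : 𝓢(EuclideanSpace ℝ (Fin 4), ℝ))
        ((v₀ : S₁) : 𝓢(EuclideanSpace ℝ (Fin 4), ℝ))) :=
    Complex.ext (by simp) (by simp [him])
  rw [← hz]
  exact (continuous_ofReal.tendsto _).comp hreal

/-- **Time-slab instance.**  Under the convergence clause: if `u_k → u₀` in `𝓢` with all `u_k, u₀` vanishing on
`{t > −δ}` and `v_k → v₀` with all `v_k, v₀` vanishing on `{t < δ}` (`δ > 0`), then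
`⟨Φ^{σ₀}_k(u_k) Φ^{σ₁}_k(v_k)⟩ → 𝔖₂^σ(u₀ ⊗ v₀)`.  (The vanishing sets are open, so these are closed submodules of `𝓢`,
and `u ⊗ v ∈ ⁰𝒮` by `isOffDiagonal_of_halfSpaces`.) [folklore] -/
theorem converges_two_along_tendsto_timeSlabs (r : LatticeRep G) (sch : SpeciesScheme (YMSpecies G))
    (S : LabelledSchwingerFamily (YMSpecies G) (EuclideanSpace ℝ (Fin 4)))
    (hconv : ∀ (n : ℕ), n ≠ 0 → ∀ (σ : Fin n → YMSpecies G) (f : Fin n → 𝓢((EuclideanSpace ℝ (Fin 4)), ℝ))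
      (F : 𝓢((Fin n → (EuclideanSpace ℝ (Fin 4))), ℂ)), IsTensorOf F (fun i => ofRealTest (f i)) →
        IsOffDiagonal F →
        Tendsto (fun k : ℕ => ((latticeSchwinger r.ρ sch (fun s => s.F) k n σ f : ℝ) : ℂ))
          atTop (𝓝 (S n σ F)))
    (σ : Fin (1 + 1) → YMSpecies G) {δ : ℝ} (hδ : 0 < δ)
    {u : ℕ → 𝓢(EuclideanSpace ℝ (Fin 4), ℝ)} {u₀ : 𝓢(EuclideanSpace ℝ (Fin 4), ℝ)}
    (hu_van : ∀ k (y : EuclideanSpace ℝ (Fin 4)), -δ < y 0 → u k y = 0)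
    (hu₀_van : ∀ y : EuclideanSpace ℝ (Fin 4), -δ < y 0 → u₀ y = 0)
    (hu : Tendsto u atTop (𝓝 u₀))
    {v : ℕ → 𝓢(EuclideanSpace ℝ (Fin 4), ℝ)} {v₀ : 𝓢(EuclideanSpace ℝ (Fin 4), ℝ)}
    (hv_van : ∀ k (y : EuclideanSpace ℝ (Fin 4)), y 0 < δ → v k y = 0)
    (hv₀_van : ∀ y : EuclideanSpace ℝ (Fin 4), y 0 < δ → v₀ y = 0)
    (hv : Tendsto v atTop (𝓝 v₀)) :
    Tendsto (fun k : ℕ => ((latticeSchwinger r.ρ sch (fun s => s.F) k (1 + 1) σ ![u k, v k] : ℝ) : ℂ))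
      atTop (𝓝 (S (1 + 1) σ (tensor₂ u₀ v₀))) := by
  -- the two closed submodules (abstractly, through their membership predicates)
  obtain ⟨S₀, hS₀⟩ : ∃ S₀ : Submodule ℝ 𝓢(EuclideanSpace ℝ (Fin 4), ℝ),
      ∀ f, f ∈ S₀ ↔ ∀ y : EuclideanSpace ℝ (Fin 4), -δ < y 0 → f y = 0 :=
    ⟨{ carrier := {f | ∀ y : EuclideanSpace ℝ (Fin 4), -δ < y 0 → f y = 0}
       add_mem' := fun {f g} hf hg y hy => by
         simp only [Set.mem_setOf_eq] at hf hg
         show f y + g y = 0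
         rw [hf y hy, hg y hy, add_zero]
       zero_mem' := fun y _ => rfl
       smul_mem' := fun c f hf y hy => by
         simp only [Set.mem_setOf_eq] at hf
         show c • f y = 0
         rw [hf y hy, smul_zero] },
      fun f => Iff.rfl⟩
  obtain ⟨S₁, hS₁⟩ : ∃ S₁ : Submodule ℝ 𝓢(EuclideanSpace ℝ (Fin 4), ℝ),
      ∀ f, f ∈ S₁ ↔ ∀ y : EuclideanSpace ℝ (Fin 4), y 0 < δ → f y = 0 :=
    ⟨{ carrier := {f | ∀ y : EuclideanSpace ℝ (Fin 4), y 0 < δ → f y = 0}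
       add_mem' := fun {f g} hf hg y hy => by
         simp only [Set.mem_setOf_eq] at hf hg
         show f y + g y = 0
         rw [hf y hy, hg y hy, add_zero]
       zero_mem' := fun y _ => rfl
       smul_mem' := fun c f hf y hy => by
         simp only [Set.mem_setOf_eq] at hf
         show c • f y = 0
         rw [hf y hy, smul_zero] },
      fun f => Iff.rfl⟩
  have hclosed : ∀ (A : Set (EuclideanSpace ℝ (Fin 4))) (S' : Submodule ℝ 𝓢(EuclideanSpace ℝ (Fin 4), ℝ)),
      (∀ f, f ∈ S' ↔ ∀ y ∈ A, f y = 0) → IsClosed (S' : Set 𝓢(EuclideanSpace ℝ (Fin 4), ℝ)) := by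
    intro A S' hS'
    have : (S' : Set 𝓢(EuclideanSpace ℝ (Fin 4), ℝ)) =
        ⋂ y ∈ A, (fun f : 𝓢(EuclideanSpace ℝ (Fin 4), ℝ) => f y) ⁻¹' {0} := by
      ext f
      simp only [SetLike.mem_coe, hS', Set.mem_iInter, Set.mem_preimage, Set.mem_singleton_iff]
    rw [this]
    exact isClosed_biInter fun y _ => isClosed_singleton.preimage (continuous_eval_schwartz y)
  have h₀ : IsClosed (S₀ : Set 𝓢(EuclideanSpace ℝ (Fin 4), ℝ)) :=
    hclosed {y | -δ < y 0} S₀ fun f => by simpa only [Set.mem_setOf_eq] using hS₀ f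
  have h₁ : IsClosed (S₁ : Set 𝓢(EuclideanSpace ℝ (Fin 4), ℝ)) :=
    hclosed {y | y 0 < δ} S₁ fun f => by simpa only [Set.mem_setOf_eq] using hS₁ f
  -- supports in the open half-spaces
  have hsupp₀ : ∀ f ∈ S₀, tsupport f ⊆ {y : EuclideanSpace ℝ (Fin 4) | y 0 < 0} := by
    intro f hf
    rw [hS₀] at hf
    have hcl : IsClosed {y : EuclideanSpace ℝ (Fin 4) | y 0 ≤ -δ} :=
      isClosed_le ((EuclideanSpace.proj (0 : Fin 4)).continuous) continuous_const
    have hs : Function.support (f : EuclideanSpace ℝ (Fin 4) → ℝ) ⊆ {y | y 0 ≤ -δ} := by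
      intro y hy
      by_contra h
      simp only [Set.mem_setOf_eq, not_le] at h
      exact hy (hf y h)
    intro y hy
    have := (closure_minimal hs hcl) hy
    simp only [Set.mem_setOf_eq] at this ⊢
    linarith
  have hsupp₁ : ∀ f ∈ S₁, tsupport f ⊆ {y : EuclideanSpace ℝ (Fin 4) | 0 < y 0} := by
    intro f hf
    rw [hS₁] at hf
    have hcl : IsClosed {y : EuclideanSpace ℝ (Fin 4) | δ ≤ y 0} :=
      isClosed_le continuous_const ((EuclideanSpace.proj (0 : Fin 4)).continuous)
    have hs : Function.support (f : EuclideanSpace ℝ (Fin 4) → ℝ) ⊆ {y | δ ≤ y 0} := by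
      intro y hy
      by_contra h
      simp only [Set.mem_setOf_eq, not_le] at h
      exact hy (hf y h)
    intro y hy
    have := (closure_minimal hs hcl) hy
    simp only [Set.mem_setOf_eq] at this ⊢
    linarith
  have hoff : ∀ a ∈ S₀, ∀ b ∈ S₁, IsOffDiagonal (tensor₂ a b) := fun a ha b hb =>
    isOffDiagonal_of_halfSpaces (hsupp₀ a ha) (hsupp₁ b hb) (isTensorOf_tensor₂ a b)
  -- package the sequences in the subspaces and apply the main theorem
  have hu' : Tendsto (fun k => (⟨u k, (hS₀ _).2 (hu_van k)⟩ : S₀)) atTop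
      (𝓝 (⟨u₀, (hS₀ _).2 hu₀_van⟩ : S₀)) := by
    rw [tendsto_subtype_rng]; exact hu
  have hv' : Tendsto (fun k => (⟨v k, (hS₁ _).2 (hv_van k)⟩ : S₁)) atTop
      (𝓝 (⟨v₀, (hS₁ _).2 hv₀_van⟩ : S₁)) := by
    rw [tendsto_subtype_rng]; exact hv
  have key := converges_two_along_tendsto r sch S hconv σ S₀ S₁ h₀ h₁ hoff hu' hv'
  exact key

end BanachSteinhaus

end Summit.QuantumFields.YangMills.Theorems.HypercubicLimit.Negative

end
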